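import Summits.AtomisticToContinuum.Crystallization.Theorems.FrustratedLawDichotomyCornerPairingHalfCap
import Summits.AtomisticToContinuum.Crystallization.Theorems.FrustratedLawDichotomyNoTwistCert

/-!
# FrustratedLawDichotomy · crux `AperiodicFrustratedLawGap` (stmt-AtomisticToContinuum-27623) — THE HALF-CAP AT EVERY CORNER, from the
# finite «no twist» certificate (decomp-a2c, prover hand 2, gen 9)

CORNER PAIRING II (p821922) built the half-cap at PATH-TYPE corners combinatorially.  Here the same construction is run at an ARBITRARY
corner `w` of a square `{a, w, b, ·}` of the link of `i` (diagonal `dist a b = √2`), the crystal pairing being supplied by the finite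
certificate `NoTwistCert θ Pat Pat'` (p822065, `noTwist_of_cert`):

* pattern facts (by `decide`, transported): a diagonal pair of the fcc pattern has exactly two common contacts
  (`fcc_ncard_common_contacts_of_diagonal`; hcp: p821922); the two common contacts of a diagonal pair are NOT in contact
  (`fcc_/hcp_common_contacts_not_adj`) — so a half-cap is never a link vertex of the centre;
* `exists_halfCap_of_diagonal_partners` — the abstract construction (neighbour's pattern `Pat'` with the two facts as hypotheses);
* ★ `exists_halfCap_of_noTwist_fcc` / `_hcp` : `NoTwistCert θ Pat fcc` (resp. `hcp`) ⟹ at a corner `w` whose neighbour `τ w` is fcc-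
  (resp. hcp-) classified, every square `{a, w, b, ·}` has a HALF-CAP `m`: `m ∼ τ a`, `m ∼ τ b`, `m ∼ τ w`, `m ≠ i`, `m ∉ range τ`.
The last metric piece of P is then «cap match»: the half-caps from the two corners `w, w''` of a square coincide
(`FrustratedLawDichotomyCapMatchCert`).  `[folklore]`; def-free; no `sorry`.
-/

noncomputable section

namespace Summit.AtomisticToContinuum.Crystallization.Theorems.FrustratedLawDichotomyHalfCap

open Literature.Geometry.DiscreteGeometry
open Summit.AtomisticToContinuum.Crystallization.Theorems.FrustratedLawDichotomyTwoShellRigidityCut (E3 LinkIso)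
open Summit.AtomisticToContinuum.Crystallization.Theorems.FrustratedLawDichotomyLinkIsoToolkit (injective_of_linkIso)
open Summit.AtomisticToContinuum.Crystallization.Theorems.FrustratedLawDichotomyCappedRigidityCertPatterns
  (dist_eq_one_iff_sqNormInt dist_eq_sqrt_two_iff_sqNormInt fcc_contactSeparating hcp_contactSeparating)
open Summit.AtomisticToContinuum.Crystallization.Theorems.FrustratedLawDichotomyCornerPairing
  (exists_partner ncard_common_contacts_scaledPattern exists_int_of_mem_scaledPattern)
open Summit.AtomisticToContinuum.Crystallization.Theorems.FrustratedLawDichotomyCornerPairingHalfCap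
  (hcp_ncard_common_contacts_of_diagonal)
open Summit.AtomisticToContinuum.Crystallization.Theorems.FrustratedLawDichotomyNoTwistCert (NoTwistCert noTwist_of_cert)

variable {θ : ℝ} {Pat Pat' : Finset E3} {N : ℕ} {y : Fin N → E3} {i : Fin N} {τ : ↥Pat → Fin N} {τ' : ↥Pat' → Fin N}

/-! ### Pattern facts -/

set_option maxRecDepth 8000 in
/-- fcc (integer model, cast form): a diagonal pair has exactly two common contacts. [folklore] -/
theorem fccInt_card_common_contacts_of_diagonal' : ∀ v ∈ fccInt, ∀ w ∈ fccInt, sqNormInt (v - w) = 2 * ((2 : ℕ) : ℤ) →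
    (fccInt.filter (fun z => sqNormInt (v - z) = ((2 : ℕ) : ℤ) ∧ sqNormInt (w - z) = ((2 : ℕ) : ℤ))).card = 2 := by
  decide

set_option maxRecDepth 8000 in
/-- fcc: the two common contacts of a diagonal pair are not in contact. [folklore] -/
theorem fccInt_common_contacts_not_adj : ∀ v ∈ fccInt, ∀ w ∈ fccInt, sqNormInt (v - w) = 2 * ((2 : ℕ) : ℤ) →
    ∀ z ∈ fccInt, ∀ z' ∈ fccInt, sqNormInt (v - z) = ((2 : ℕ) : ℤ) → sqNormInt (w - z) = ((2 : ℕ) : ℤ) →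
      sqNormInt (v - z') = ((2 : ℕ) : ℤ) → sqNormInt (w - z') = ((2 : ℕ) : ℤ) → z ≠ z' → sqNormInt (z - z') ≠ ((2 : ℕ) : ℤ) := by
  decide

set_option maxRecDepth 8000 in
/-- hcp: the two common contacts of a diagonal pair are not in contact. [folklore] -/
theorem hcpInt_common_contacts_not_adj : ∀ v ∈ hcpInt, ∀ w ∈ hcpInt, sqNormInt (v - w) = 2 * ((18 : ℕ) : ℤ) →
    ∀ z ∈ hcpInt, ∀ z' ∈ hcpInt, sqNormInt (v - z) = ((18 : ℕ) : ℤ) → sqNormInt (w - z) = ((18 : ℕ) : ℤ) →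
      sqNormInt (v - z') = ((18 : ℕ) : ℤ) → sqNormInt (w - z') = ((18 : ℕ) : ℤ) → z ≠ z' → sqNormInt (z - z') ≠ ((18 : ℕ) : ℤ) := by
  decide

/-- **fcc: a diagonal pair of the fcc kissing pattern has exactly two common contacts.** [folklore] -/
theorem fcc_ncard_common_contacts_of_diagonal (u a : ↥fccKissingPattern) (h : dist (u : E3) (a : E3) = Real.sqrt 2) :
    ({c : ↥fccKissingPattern | dist (u : E3) (c : E3) = 1} ∩ {c : ↥fccKissingPattern | dist (a : E3) (c : E3) = 1}).ncard = 2 := by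
  obtain ⟨v₀, hv₀, hv⟩ := exists_int_of_mem_scaledPattern u
  obtain ⟨z₀, hz₀, hz⟩ := exists_int_of_mem_scaledPattern a
  have hd : sqNormInt (v₀ - z₀) = 2 * ((2 : ℕ) : ℤ) := by
    rw [← hv, ← hz] at h
    exact (dist_eq_sqrt_two_iff_sqNormInt two_ne_zero v₀ z₀).1 h
  have key := fccInt_card_common_contacts_of_diagonal' v₀ hv₀ z₀ hz₀ hd
  rw [← ncard_common_contacts_scaledPattern two_ne_zero u a hv hz] at key
  exact key

/-- Transport of «common contacts of a diagonal pair are not in contact» to a scaled pattern. [folklore] -/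
theorem common_contacts_not_adj_scaledPattern {S : Finset (Fin 3 → ℤ)} {N₀ : ℕ} (hN : N₀ ≠ 0)
    (hS : ∀ v ∈ S, ∀ w ∈ S, sqNormInt (v - w) = 2 * (N₀ : ℤ) → ∀ z ∈ S, ∀ z' ∈ S, sqNormInt (v - z) = (N₀ : ℤ) →
      sqNormInt (w - z) = (N₀ : ℤ) → sqNormInt (v - z') = (N₀ : ℤ) → sqNormInt (w - z') = (N₀ : ℤ) → z ≠ z' →
      sqNormInt (z - z') ≠ (N₀ : ℤ))
    (u a c c' : ↥(scaledPattern S N₀)) (h : dist (u : E3) (a : E3) = Real.sqrt 2)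
    (h1 : dist (u : E3) (c : E3) = 1) (h2 : dist (a : E3) (c : E3) = 1) (h3 : dist (u : E3) (c' : E3) = 1)
    (h4 : dist (a : E3) (c' : E3) = 1) (hne : c ≠ c') : dist (c : E3) (c' : E3) ≠ 1 := by
  obtain ⟨v₀, hv₀, hv⟩ := exists_int_of_mem_scaledPattern u
  obtain ⟨w₀, hw₀, hw⟩ := exists_int_of_mem_scaledPattern a
  obtain ⟨z₀, hz₀, hz⟩ := exists_int_of_mem_scaledPattern c
  obtain ⟨z₁, hz₁, hz'⟩ := exists_int_of_mem_scaledPattern c'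
  rw [← hv, ← hw] at h
  have hd := (dist_eq_sqrt_two_iff_sqNormInt hN v₀ w₀).1 h
  rw [← hv, ← hz] at h1; rw [← hw, ← hz] at h2; rw [← hv, ← hz'] at h3; rw [← hw, ← hz'] at h4
  have hzz : z₀ ≠ z₁ := by
    intro hzz; apply hne; apply Subtype.ext; rw [← hz, ← hz', hzz]
  have key := hS v₀ hv₀ w₀ hw₀ hd z₀ hz₀ z₁ hz₁ ((dist_eq_one_iff_sqNormInt hN v₀ z₀).1 h1)
    ((dist_eq_one_iff_sqNormInt hN w₀ z₀).1 h2) ((dist_eq_one_iff_sqNormInt hN v₀ z₁).1 h3)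
    ((dist_eq_one_iff_sqNormInt hN w₀ z₁).1 h4) hzz
  rw [← hz, ← hz']
  exact fun h' => key ((dist_eq_one_iff_sqNormInt hN z₀ z₁).1 h')

/-- fcc: the two common contacts of a diagonal pair are not in contact. [folklore] -/
theorem fcc_common_contacts_not_adj (u a c c' : ↥fccKissingPattern) (h : dist (u : E3) (a : E3) = Real.sqrt 2)
    (h1 : dist (u : E3) (c : E3) = 1) (h2 : dist (a : E3) (c : E3) = 1) (h3 : dist (u : E3) (c' : E3) = 1)
    (h4 : dist (a : E3) (c' : E3) = 1) (hne : c ≠ c') : dist (c : E3) (c' : E3) ≠ 1 :=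
  common_contacts_not_adj_scaledPattern two_ne_zero fccInt_common_contacts_not_adj u a c c' h h1 h2 h3 h4 hne

/-- hcp: the two common contacts of a diagonal pair are not in contact. [folklore] -/
theorem hcp_common_contacts_not_adj (u a c c' : ↥hcpKissingPattern) (h : dist (u : E3) (a : E3) = Real.sqrt 2)
    (h1 : dist (u : E3) (c : E3) = 1) (h2 : dist (a : E3) (c : E3) = 1) (h3 : dist (u : E3) (c' : E3) = 1)
    (h4 : dist (a : E3) (c' : E3) = 1) (hne : c ≠ c') : dist (c : E3) (c' : E3) ≠ 1 :=
  common_contacts_not_adj_scaledPattern (by norm_num) hcpInt_common_contacts_not_adj u a c c' h h1 h2 h3 h4 hne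

/-! ### The half-cap from a diagonal pair on the neighbour's side -/

/-- **The abstract half-cap construction.**  `LinkIso θ Pat y i τ`; neighbour `τ w` classified by `Pat'` via `τ'`, `τ' w' = i`; `a, b`
contacts of `w` whose partners `a', b'` form a DIAGONAL pair of `Pat'`; `Pat'`-facts: that diagonal pair has exactly two common contacts, and
those are not in contact.  Then a half-cap exists. [folklore] -/
theorem exists_halfCap_of_diagonal_partners (hτ' : Function.Injective τ') (hL : LinkIso θ Pat y i τ) (w : ↥Pat)
    (hL' : LinkIso θ Pat' y (τ w) τ') {w' : ↥Pat'} (hw' : τ' w' = i)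
    {a b : ↥Pat} {a' b' : ↥Pat'} (ha'w : dist (w' : E3) (a' : E3) = 1) (hb'w : dist (w' : E3) (b' : E3) = 1)
    (ha' : τ' a' = τ a) (hb' : τ' b' = τ b) (_hdiag : dist (a' : E3) (b' : E3) = Real.sqrt 2)
    (h2 : ({c : ↥Pat' | dist (a' : E3) (c : E3) = 1} ∩ {c : ↥Pat' | dist (b' : E3) (c : E3) = 1}).ncard = 2)
    (hna : ∀ c c' : ↥Pat', dist (a' : E3) (c : E3) = 1 → dist (b' : E3) (c : E3) = 1 → dist (a' : E3) (c' : E3) = 1 →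
      dist (b' : E3) (c' : E3) = 1 → c ≠ c' → dist (c : E3) (c' : E3) ≠ 1) :
    ∃ m : Fin N, m ≠ i ∧ (bondGraph θ y).Adj m (τ a) ∧ (bondGraph θ y).Adj m (τ b) ∧ (bondGraph θ y).Adj m (τ w) ∧
      m ∉ Set.range τ := by
  obtain ⟨x₁, x₂, hne, hS⟩ := Set.ncard_eq_two.1 h2
  have hw'mem : w' ∈ ({c : ↥Pat' | dist (a' : E3) (c : E3) = 1} ∩ {c : ↥Pat' | dist (b' : E3) (c : E3) = 1}) :=
    ⟨by show dist (a' : E3) (w' : E3) = 1; rw [dist_comm]; exact ha'w,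
     by show dist (b' : E3) (w' : E3) = 1; rw [dist_comm]; exact hb'w⟩
  obtain ⟨x', hx'mem, hx'ne⟩ : ∃ x', x' ∈ ({c : ↥Pat' | dist (a' : E3) (c : E3) = 1} ∩
      {c : ↥Pat' | dist (b' : E3) (c : E3) = 1}) ∧ x' ≠ w' := by
    have hw2 := hw'mem
    rw [hS] at hw2 ⊢
    simp only [Set.mem_insert_iff, Set.mem_singleton_iff] at hw2
    rcases hw2 with h | h
    · exact ⟨x₂, by simp, fun e => hne (h.symm.trans e.symm)⟩
    · exact ⟨x₁, by simp, fun e => hne (e.trans h)⟩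
  obtain ⟨hx'a, hx'b⟩ := hx'mem
  refine ⟨τ' x', ?_, ?_, ?_, ?_, ?_⟩
  · intro h
    exact hx'ne (hτ' (h.trans hw'.symm))
  · rw [← ha']
    exact (hL'.2.2 x' a').2 (by rw [dist_comm]; exact hx'a)
  · rw [← hb']
    exact (hL'.2.2 x' b').2 (by rw [dist_comm]; exact hx'b)
  · exact (hL'.1 x').symm
  · -- a link vertex of `i` equal to `τ' x'` would make `x'` a contact of `w'`, i.e. a common contact of `a', b'` in contact with the
    -- other common contact `w'` — excluded by `hna`.
    rintro ⟨z, hz⟩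
    have hadj : (bondGraph θ y).Adj (τ' w') (τ' x') := by
      rw [hw', ← hz]; exact hL.1 z
    have hwx : dist (w' : E3) (x' : E3) = 1 := (hL'.2.2 w' x').1 hadj
    exact hna w' x' (by rw [dist_comm]; exact ha'w) (by rw [dist_comm]; exact hb'w) hx'a hx'b hx'ne.symm hwx

/-- **★ The half-cap at every corner, neighbour fcc-classified, from `NoTwistCert θ Pat fcc`.** [folklore] -/
theorem exists_halfCap_of_noTwist_fcc
    (hPat : ∀ u v : ↥Pat, u ≠ v → ∃ c : ↥Pat, dist (u : E3) (c : E3) = 1 ∧ dist (v : E3) (c : E3) ≠ 1)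
    (hcert : NoTwistCert θ Pat fccKissingPattern) {τ' : ↥fccKissingPattern → Fin N} (hy : Function.Injective y)
    (hL : LinkIso θ Pat y i τ) (w : ↥Pat) (hL' : LinkIso θ fccKissingPattern y (τ w) τ') {w' : ↥fccKissingPattern}
    (hw' : τ' w' = i) {a b : ↥Pat} (ha : dist (w : E3) (a : E3) = 1) (hb : dist (w : E3) (b : E3) = 1)
    (hab : dist (a : E3) (b : E3) = Real.sqrt 2) :
    ∃ m : Fin N, m ≠ i ∧ (bondGraph θ y).Adj m (τ a) ∧ (bondGraph θ y).Adj m (τ b) ∧ (bondGraph θ y).Adj m (τ w) ∧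
      m ∉ Set.range τ := by
  have hτ' : Function.Injective τ' := injective_of_linkIso fcc_contactSeparating hL'
  obtain ⟨a', ha'w, ha', -⟩ := exists_partner hτ' hL w hL' hw' ha
  obtain ⟨b', hb'w, hb', -⟩ := exists_partner hτ' hL w hL' hw' hb
  have hdiag : dist (a' : E3) (b' : E3) = Real.sqrt 2 :=
    noTwist_of_cert hPat fcc_contactSeparating hcert hy hL w hL' hw' ha hb ha' hb' hab
  exact exists_halfCap_of_diagonal_partners hτ' hL w hL' hw' ha'w hb'w ha' hb' hdiag
    (fcc_ncard_common_contacts_of_diagonal a' b' hdiag) (fun c c' h1 h2 h3 h4 hne => fcc_common_contacts_not_adj a' b' c c' hdiag h1 h2 h3 h4 hne)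

/-- **★ The half-cap at every corner, neighbour hcp-classified, from `NoTwistCert θ Pat hcp`.** [folklore] -/
theorem exists_halfCap_of_noTwist_hcp
    (hPat : ∀ u v : ↥Pat, u ≠ v → ∃ c : ↥Pat, dist (u : E3) (c : E3) = 1 ∧ dist (v : E3) (c : E3) ≠ 1)
    (hcert : NoTwistCert θ Pat hcpKissingPattern) {τ' : ↥hcpKissingPattern → Fin N} (hy : Function.Injective y)
    (hL : LinkIso θ Pat y i τ) (w : ↥Pat) (hL' : LinkIso θ hcpKissingPattern y (τ w) τ') {w' : ↥hcpKissingPattern}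
    (hw' : τ' w' = i) {a b : ↥Pat} (ha : dist (w : E3) (a : E3) = 1) (hb : dist (w : E3) (b : E3) = 1)
    (hab : dist (a : E3) (b : E3) = Real.sqrt 2) :
    ∃ m : Fin N, m ≠ i ∧ (bondGraph θ y).Adj m (τ a) ∧ (bondGraph θ y).Adj m (τ b) ∧ (bondGraph θ y).Adj m (τ w) ∧
      m ∉ Set.range τ := by
  have hτ' : Function.Injective τ' := injective_of_linkIso hcp_contactSeparating hL'
  obtain ⟨a', ha'w, ha', -⟩ := exists_partner hτ' hL w hL' hw' ha
  obtain ⟨b', hb'w, hb', -⟩ := exists_partner hτ' hL w hL' hw' hb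
  have hdiag : dist (a' : E3) (b' : E3) = Real.sqrt 2 :=
    noTwist_of_cert hPat hcp_contactSeparating hcert hy hL w hL' hw' ha hb ha' hb' hab
  exact exists_halfCap_of_diagonal_partners hτ' hL w hL' hw' ha'w hb'w ha' hb' hdiag
    (hcp_ncard_common_contacts_of_diagonal a' b' hdiag) (fun c c' h1 h2 h3 h4 hne => hcp_common_contacts_not_adj a' b' c c' hdiag h1 h2 h3 h4 hne)

end Summit.AtomisticToContinuum.Crystallization.Theorems.FrustratedLawDichotomyHalfCap

end
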